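import Summits.CriticalPhenomena.PercolationContinuityZ3.Theorems.Transplant.SkelNeg1ChoiceL
import HarnessLib

/-!
# N1 ({±1} node), (F) column under the re-ordered, LENGTH-BUDGETED closure (B.19 / (Q′-3), 'L' pair of record, p3-g11 2026-08-22T03:03:22Z):
# **THE KEYSTONE'S BOUNDED INNER-CHAIN HYPOTHESIS FROM THE HANDED-DOWN FACE CHAIN FACT** — `PlanarSkeletonNeg.hchain_of_chainFactL`: the face
# obligation `FaceHoldsRNOFnL Lf 𝒞₀` of the closure `samePDropOfSkeletonNeg₁_of_choiceFnNOWL` (p3-g11, `SkelNeg1ChoiceL`) hands the (F) discharger `ChainFactL Lf G Δ κ` (linked chains of `n + 1 ≤ Lf κ.K₀ + 1`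
# target steps, kits at the flat root accuracy `κ.δr 0`, conclusion `1 − κ.δ₂²`); the keystone `Skelφ.hkits_faceSteps_of_nums6` asks its
# inner-chain fact `hchain` at the KIT accuracy `δ` for every chain `0 + 1 + Nr + 1 + N₃ ≤ nF` (design-owner delta, lane INBOX
# 2026-08-22T02:23:54Z).  This file is the one-step adapter: for `δ ≤ κ.δr 0` (kits monotone in the accuracy, `KitsAt.mono`),
# `nF ≤ Lf κ.K₀` and `q < 1`, `ChainFactL` gives `hchain` verbatim — so the (F) wrapper discharges `hchain` by `ChainFactL` + `δkit ≤ κ.δr 0`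
# with no `δUP` range anywhere.
builds on p205010 (kernel theorem, internal audit signed; external expert review pending) — nothing in this file uses p205010; NOTHING is claimed
about the open node `SamePDropOfSkeletonNeg`.
Lane `prim-bschramm`, seat `prim-hp-8` (gen 35; (F) column); helper file (`--supports stmt-CriticalPhenomena-4575 --as helper`).
* **`PlanarSkeletonNeg.hchain_of_chainFactL`**, **`PlanarSkeletonNeg.faceHoldsRNOFnL_of_residue`** (tuple-generic glue).
[cite: KozmaNitzan2024, §4 Lemma 10 (pp. 17–21), Theorem 6 (pp. 25–31)] [folklore]
-/

noncomputable section

open MeasureTheory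
open scoped Classical

namespace Summit.CriticalPhenomena.PercolationContinuityZ3.Theorems.Transplant

namespace PlanarSkeletonNeg

open Literature.Probability.Percolation Literature.Probability.LatticeModels KNLevels
open Literature.Barriers.CriticalPhenomena (HasExponentialGrowth)
open SkelConc (Consts)

variable {V : Type} [DecidableEq V] [Countable V] {G : SimpleGraph V} [G.LocallyFinite]

/-- **The keystone's bounded `hchain` from `ChainFactL`**: at any kit accuracy `δ ≤ κ.δr 0`, any `q < 1`, any budget `nF ≤ Lf κ.K₀` and any
window radius `r`, the handed-down face chain fact gives the inner-chain hypothesis of `Skelφ.hkits_faceSteps_of_nums6` (shape verbatim).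
[cite: KozmaNitzan2024, §4 Lemma 10 (pp. 17–21)] -/
theorem hchain_of_chainFactL (Lf : ℕ → ℕ) (κ : Consts) {Δ : ℕ} (hCF : ChainFactL Lf G Δ κ) {q : unitInterval} (hq : (q : ℝ) < 1)
    {δ : ℝ} (hδ : δ ≤ κ.δr 0) {nF : ℕ} (hnF : nF ≤ Lf κ.K₀) (r : ℕ) :
    ∀ (c : V) (Nr N₃ : ℕ), 0 + 1 + Nr + 1 + N₃ ≤ nF → ∀ (W : Sym2 V → unitInterval)
      (s : Fin (0 + 1 + Nr + 1 + N₃ + 1) → TStep (Skel.winGraph G c r)) (T' : Fin (0 + 1 + Nr + 1 + N₃ + 1) → Finset V) (η : ℝ),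
      (∀ i, (s i).L.o = (s 0).L.o) →
      (∀ i : Fin (0 + 1 + Nr + 1 + N₃), T' (Fin.castSucc i) ⊆ (s i.succ).L.X 0) →
      (∀ i, T' i ⊆ (s i).T) →
      (∀ i, (s i).KitsAt W q Δ δ) →
      η ≤ δ / 2 →
      (∀ i, (prodBernoulli W).real (⋃ t ∈ (s i).T \ T' i, openConn (s 0).L.o t) ≤ η) →
      1 - δ < (prodBernoulli W).real (s 0).L.reachB →
        1 - κ.δ₂ ^ 2 < (prodBernoulli W).real (⋃ t ∈ T' (Fin.last (0 + 1 + Nr + 1 + N₃)), openConn (s 0).L.o t) := by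
  intro c Nr N₃ hn W s T' η ho hlk hT hk hη hex hsrc
  exact hCF (0 + 1 + Nr + 1 + N₃) (hn.trans hnF) q hq c r W s T' η ho hlk hT (fun i => (hk i).mono hδ) (by linarith) hex (by linarith)

/-- **`FaceHoldsRNOFnL Lf 𝒞₀` from the per-point face residue** (tuple-generic glue over `ChoiceFnNO`; the (Q′-3) twin of
`faceHoldsRNOFn_negChoiceAllOT_of`; not to be confused with p3-g11's lift `faceHoldsRNOFnL_of` from the obligation of record): at every `(κ, G, Φ, t, p, hC, O, q)` with `FlatL`, `ChainFactL` and `AtQO`, the residue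
`Skelφ.FaceOblRM G (scheme O q) (FD O q) Φ.Δ κ.δ₂` of the choice function's scheme / face data gives the obligation. [folklore] -/
theorem faceHoldsRNOFnL_of_residue (Lf : ℕ → ℕ) (𝒞₀ : ChoiceFnNO)
    (h : ∀ (κ : Consts) {V : Type} [DecidableEq V] [Countable V] (G : SimpleGraph V) [G.LocallyFinite] (Φ : PlanarSkeletonNeg G)
      (hg : ¬ HasExponentialGrowth G) (t : V) (ht : t ∈ Φ.types) (h1 : Φ.types = {t}) (p : unitInterval) (hp0 : 0 < (p : ℝ)) (hp1 : (p : ℝ) < 1)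
      (hC : Φ.CylSubcritical p) (O : Skelφ.StepI.OutO V) (q : unitInterval),
      FlatL Lf κ → ChainFactL Lf G Φ.Δ κ → (𝒞₀ κ G Φ hg t ht h1 p hp0 hp1 hC).AtQO O q →
        Skelφ.FaceOblRM G ((𝒞₀ κ G Φ hg t ht h1 p hp0 hp1 hC).scheme O q) ((𝒞₀ κ G Φ hg t ht h1 p hp0 hp1 hC).FD O q) Φ.Δ κ.δ₂) :
    FaceHoldsRNOFnL Lf 𝒞₀ :=
  fun κ _ _ _ G _ Φ hg t ht h1 p hp0 hp1 hC hFl hCF O q hAt => h κ G Φ hg t ht h1 p hp0 hp1 hC O q hFl hCF hAt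

end PlanarSkeletonNeg

end Summit.CriticalPhenomena.PercolationContinuityZ3.Theorems.Transplant

end
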